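import Summits.BirchSwinnertonDyer.BirchSwinnertonDyer.Theorems.PrintX10bControlDiscreteGlue
import Summits.BirchSwinnertonDyer.BirchSwinnertonDyer.Theorems.PrintX10bControlCompactGlueSetting
import Summits.BirchSwinnertonDyer.BirchSwinnertonDyer.Theorems.PrintX9MuPartStabilizedCoherentPairOfCyclic
import Literature.NumberTheory.EllipticCurves.ZpExtensionEisensteinDVRSetting
import Literature.NumberTheory.EllipticCurves.LambdaAdicSelmerDataToEisensteinH1Linear
import Literature.NumberTheory.EllipticCurves.ZpExtensionEisensteinPinnedSelmerGlueProofs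
import Literature.NumberTheory.EllipticCurves.ZpExtensionEisensteinTowerReadoutCurve
import Literature.NumberTheory.EllipticCurves.ZpExtensionEisensteinReadoutScalarCompatProofs
import Literature.NumberTheory.EllipticCurves.OrdinaryReductionAscentProofs
import Literature.NumberTheory.EllipticCurves.Greenberg1999.KummerImageGoodOrdinaryNumberField
import Literature.NumberTheory.GaloisCohomology.Howard2004.DVRKolyvaginBound
import HarnessLib

/-!
# KS-TWINS of the control-glue letters: the leaf (CG) replaced by the FRAME-RESTRICTED Kummer = strict letter
# (CG-FRAME (E), cell `pub/bsd-print-x9`; pen g14 «GO w3: CG-FRAME» 2026-08-29T00:29Z; seat bsd-line-x10b-p1 LEAD g10)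

Summits-side helper, ROUTE-INDEPENDENT (no `Theses` import): statement ABBREVIATIONS (letters, nothing asserted) and ONE
theorem; no named fact, no instance, no `sorry`. This file is `PrintX10bControlGlueOfClauses` (x10b-p1-w2 g10, p669215 ff.)
VERBATIM except that the leading binder of every letter — the cite-only leaf
`hCG : Greenberg1999.imKummer_eq_strictCondition_goodOrdinary_numberField` (Greenberg LNM 1716 Prop. 2.4 for EVERY number field,
curve, ramified `ℤ_p`-extension and layer) — is replaced by the frame-restricted letter **`Stmt.kummerStrictOnFrames`**: the
Kummer = strict EQUATION `E_K.localKerOver p (ker κ) K_v = (E_K.kernelOfReductionLocalDatum p v).strictKer (ker κ)` ONLY for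
`K` imaginary quadratic, `p ≠ 2` split in `K` (`SatisfiesHeegnerHypothesis p K`), `κ` anticyclotomic, `E = W_K` the base change
of a rational curve, `v ∣ p` good ordinary ramified in `K_∞` — exactly the instances the μ-chain consumes (sites:
`eisensteinTowerReadout_of_mem_localKerOver`, `exists_grMk_eq_coboundary_of_mem_localKerOver`; KS-twins of those in
`Literature/…/ZpExtensionEisensteinReadoutOrdinaryLocalKummerStrictProofs`). Purpose: when the CG-FRAME files (A)–(D)
(x9-p1-w3 g11) prove `Stmt.kummerStrictOnFrames` in the kernel, the aside `MuInequalityCoherentPairOfPrint`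
(stmt-BirchSwinnertonDyer-23237 = the μ-crux WITHOUT the leaf hCG) closes by name through these twins; until then they are
letters. Decls: `Stmt.kummerStrictOnFrames`, `Stmt.readoutSelmerKS`, `Stmt.readoutIndexKS`, `Stmt.controlGlueKS`,
`controlGlueKS_of_clauses` (proof verbatim `controlGlue_of_clauses`). HONEST FRAMING: nothing is discharged here;
«beyond-print theorem»: no. BSD is not proved by any of this; no summit statement is proved by this seat.

References: [Howard2004HeegnerKolyvagin] Thm. 1.6.1, Prop. 2.2.8 and proof of Thm. 2.2.10 (𝔮 = T^m + p);
[GreenbergLNM1716] Prop. 2.4, §4 p. 98; [MastellaZerman2026] Thm. 2.40.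
-/

set_option linter.dupNamespace false
set_option autoImplicit false

noncomputable section

open scoped Classical Pointwise ContRepresentation TensorProduct NumberField

open Function NumberField IsDedekindDomain Field
open Literature Literature.NumberTheory.EllipticCurves WeierstrassCurve
open Literature.NumberTheory.GaloisCohomology Literature.NumberTheory.GaloisCohomology.Howard2004
open Literature.NumberTheory.GaloisRepresentations Literature.NumberTheory.GaloisRepresentations.DiscreteGaloisModule
open Summit.BirchSwinnertonDyer.BirchSwinnertonDyer.Theorems

namespace Summit.BirchSwinnertonDyer.BirchSwinnertonDyer.Theorems.HeegnerMuPartControlGlue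

/-! ## §0 The frame-restricted Kummer = strict letter -/

/-- **Letter `kummerStrictOnFrames`** (the frame-restricted form of Greenberg LNM 1716 Prop. 2.4 = Coates–Greenberg at the layer
`K_∞`): for `K` imaginary quadratic, `p ≠ 2` with `SatisfiesHeegnerHypothesis p K` (`p` split), `κ` an anticyclotomic
`ℤ_p`-extension, `W/ℚ` elliptic and `v ∣ p` a place of good ordinary reduction of `W_K` ramified in `K_∞`, the local Kummer
condition over `K_{∞}` at `v` equals Greenberg's strict condition for `C_v = E[p^∞] ∩ E₁(K̄_v)`:
`W_K.localKerOver p (ker κ) K_v = (W_K.kernelOfReductionLocalDatum p v).strictKer (ker κ)` (Greenberg LNM 1716 Prop. 2.4,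
Coates–Greenberg Prop. 4.3, restricted to these frames). A statement LETTER like `Stmt.readoutSelmer` — a hypothesis shape of this
chain, not a citable fact and not asserted; the CG-FRAME files (A)–(D) are to prove it as a theorem. -/
abbrev Stmt.kummerStrictOnFrames : Prop :=
  ∀ (K : Type) [Field K] [NumberField K] (W : WeierstrassCurve ℚ) [W.IsElliptic] (p : ℕ) [Fact p.Prime]
    (κ : ZpExtension K p) (v : IsDedekindDomain.HeightOneSpectrum (NumberField.RingOfIntegers K)),
    IsImaginaryQuadratic K → p ≠ 2 → SatisfiesHeegnerHypothesis p K → κ.IsAnticyclotomic →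
    ((p : ℕ) : NumberField.RingOfIntegers K) ∈ v.asIdeal →
    (W.baseChange K).HasGoodReductionAt v → (W.baseChange K).HasUnitRootAt v →
    (∃ 𝔓 ∈ v.primesAbove, ¬ 𝔓.inertia (Field.absoluteGaloisGroup K) ≤ κ.kerSubgroup) →
    (W.baseChange K).localKerOver p κ.kerSubgroup (v.adicCompletion K) =
      ((W.baseChange K).kernelOfReductionLocalDatum p v).strictKer κ.kerSubgroup

/-! ## §1 The letters (KS-twins) -/

set_option synthInstance.maxHeartbeats 80000 in
/-- **KS-twin of letter (B4) `readoutSelmer`** (leading binder `Stmt.kummerStrictOnFrames` instead of the leaf hCG) — the image of Howard's propagated Selmer group `H¹_{F_𝔮}(K, A_𝔮)` under the readout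
`H¹(K, A_𝔮) → H¹(K_∞, E[p^∞])` lies in `Sel_{p^∞}(E/K_∞)`, for `m ≫ 0` and every admissible Eisenstein datum (x10b-p2's
local conditions §2; Greenberg LNM 1716 Prop. 2.4 = the Kummer image at `w ∣ p` is its leading binder). -/
abbrev Stmt.readoutSelmerKS : Prop :=
  Stmt.kummerStrictOnFrames →
  ∀ (N : ℕ) [NeZero N] (W : WeierstrassCurve ℚ) [W.IsGloballyMinimal] (K : Type) [Field K] [NumberField K]
    (p : ℕ) [Fact p.Prime] (κ : ZpExtension K p) (γ : Field.absoluteGaloisGroup K)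
    (jbar : AlgebraicClosure K →+* ℂ) (hyp : CastellaGrossiLeeSkinner2022.Thm413Hypotheses N W K p κ γ),
    ¬ W.HasCM → W.HasIrreducibleModPGaloisRep p → (W.baseChange K).HasIrreducibleModPGaloisRep p →
    MastellaZerman2026.HasPadicScalarImage W p → SatisfiesHeegnerHypothesis p K →
    p ∣ NumberField.classNumber K →
    ∃ m₁ : ℕ, ∀ (m : ℕ) (hm : 1 ≤ m), m₁ ≤ m →
      haveI := hyp.isElliptic
      letI := IwasawaAlgebra.isDomain_quotient_X_pow_add_C p hm
      letI := IwasawaAlgebra.isDiscreteValuationRing_quotient_X_pow_add_C p hm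
      haveI := IwasawaAlgebra.EisensteinCoeff.isLocalRing_succ p hm
      letI := IwasawaAlgebra.EisensteinCoeff.algebraOfSpecSucc p m
      haveI := W.isScalarTower_algebraOfSpecSucc (K := K) (p := p) (m := m)
      letI := W.residueModuleSucc (K := K) (p := p) hm
      ∀ (S : Finset (IsDedekindDomain.HeightOneSpectrum (NumberField.RingOfIntegers K)))
        (hpS : ∀ v, ((p : ℕ) : NumberField.RingOfIntegers K) ∈ v.asIdeal → v ∈ S)
        (hbad : ∀ v, v ∉ S → ((p : ℕ) : NumberField.RingOfIntegers K) ∉ v.asIdeal →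
          (W.baseChange K).HasGoodReductionAt v)
        (_hSN : ∀ v ∈ S, ((p : ℕ) : NumberField.RingOfIntegers K) ∈ v.asIdeal ∨
          ((N : ℕ) : NumberField.RingOfIntegers K) ∈ v.asIdeal)
        (_hSσ : ∀ (σ : K ≃ₐ[ℚ] K) (v : IsDedekindDomain.HeightOneSpectrum (NumberField.RingOfIntegers K)),
          σ • v ∈ S → v ∈ S)
        (L : Set (IsDedekindDomain.HeightOneSpectrum (NumberField.RingOfIntegers K)))
        (hL : L ⊆ (W.eisensteinTower (κ.unitTwist (-1)) hm).degreeTwoPrimes p)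
        (hLS : ∀ v ∈ L, v ∉ S) (jbar' : AlgebraicClosure K →+* ℂ) (cd : ConjugationDatum K)
        (Dd : ∀ k, DualityDatum p cd ((W.eisensteinTower (κ.unitTwist (-1)) hm).ρ k)
          (IwasawaAlgebra.EisensteinCoeff p m (k + 1)))
        (fs : ∀ (k : ℕ) (n : Finset (IsDedekindDomain.HeightOneSpectrum (NumberField.RingOfIntegers K)))
          (v : IsDedekindDomain.HeightOneSpectrum (NumberField.RingOfIntegers K)),
          galoisCohomology ((W.eisensteinLevelQuot (κ.unitTwist (-1)) hm k n).toLocal (Sum.inr v)) 1 →+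
            SingularQuotient (GaloisRep.toLocal v (W.eisensteinLevelQuot (κ.unitTwist (-1)) hm k n)) ⊗[ℤ]
              Gell v)
        (hy : (W.eisensteinDVRSetting (κ.unitTwist (-1)) hm S hpS hbad L hL hLS jbar' cd Dd fs).SatisfiesH)
        (hπ : (W.eisensteinDVRSetting (κ.unitTwist (-1)) hm S hpS hbad L hL hLS jbar' cd Dd fs).π ∈ IsLocalRing.maximalIdeal (IwasawaAlgebra p ⧸ Ideal.span {(PowerSeries.X ^ m + PowerSeries.C (p : ℤ_[p]) : IwasawaAlgebra p)}))
        (he : ∀ k, (W.eisensteinDVRSetting (κ.unitTwist (-1)) hm S hpS hbad L hL hLS jbar' cd Dd fs).e k ≤ (W.eisensteinDVRSetting (κ.unitTwist (-1)) hm S hpS hbad L hL hLS jbar' cd Dd fs).e (k + 1))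
        (hπX : (W.eisensteinDVRSetting (κ.unitTwist (-1)) hm S hpS hbad L hL hLS jbar' cd Dd fs).π =
          Ideal.Quotient.mk (Ideal.span {(PowerSeries.X ^ m + PowerSeries.C (p : ℤ_[p]) : IwasawaAlgebra p)}) PowerSeries.X)
        (hek : ∀ k, (W.eisensteinDVRSetting (κ.unitTwist (-1)) hm S hpS hbad L hL hLS jbar' cd Dd fs).e (k + 1) - (W.eisensteinDVRSetting (κ.unitTwist (-1)) hm S hpS hbad L hL hLS jbar' cd Dd fs).e k = m),
        ∀ a ∈ ((W.eisensteinDVRSetting (κ.unitTwist (-1)) hm S hpS hbad L hL hLS jbar' cd Dd fs).T.selmerA (W.eisensteinDVRSetting (κ.unitTwist (-1)) hm S hpS hbad L hL hLS jbar' cd Dd fs).π (W.eisensteinDVRSetting (κ.unitTwist (-1)) hm S hpS hbad L hL hLS jbar' cd Dd fs).e hy.killed hy.ker_red hπ he (fun k ↦ ((W.eisensteinDVRSetting (κ.unitTwist (-1)) hm S hpS hbad L hL hLS jbar' cd Dd fs).t k).cond)),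
          (W.eisensteinTowerReadout κ hm (W.eisensteinDVRSetting (κ.unitTwist (-1)) hm S hpS hbad L hL hLS jbar' cd Dd fs).π (W.eisensteinDVRSetting (κ.unitTwist (-1)) hm S hpS hbad L hL hLS jbar' cd Dd fs).e hy.killed hy.ker_red hπ he hπX hek) a ∈ (W.baseChange K).selmerInfty κ

set_option synthInstance.maxHeartbeats 80000 in
/-- **KS-twin of letter (B5) `readoutIndex`** (leading binder `Stmt.kummerStrictOnFrames` instead of the leaf hCG) — the m-UNIFORM index bound: for `m ≫ 0` and every admissible Eisenstein datum,
`Sel_{p^∞}(E/K_∞)[(conj_γ − 1)^m + p]` modulo the readout of `H¹_{F_𝔮}(K, A_𝔮)` is finite of order `≤ p^c`, `c` independent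
of `m` (Howard Prop. 2.2.8, second map, at `𝔮 = T^m + p`; x10b-p2's §2 cokernel). -/
abbrev Stmt.readoutIndexKS : Prop :=
  Stmt.kummerStrictOnFrames →
  ∀ (N : ℕ) [NeZero N] (W : WeierstrassCurve ℚ) [W.IsGloballyMinimal] (K : Type) [Field K] [NumberField K]
    (p : ℕ) [Fact p.Prime] (κ : ZpExtension K p) (γ : Field.absoluteGaloisGroup K)
    (jbar : AlgebraicClosure K →+* ℂ) (hyp : CastellaGrossiLeeSkinner2022.Thm413Hypotheses N W K p κ γ),
    ¬ W.HasCM → W.HasIrreducibleModPGaloisRep p → (W.baseChange K).HasIrreducibleModPGaloisRep p →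
    MastellaZerman2026.HasPadicScalarImage W p → SatisfiesHeegnerHypothesis p K →
    p ∣ NumberField.classNumber K →
    ∃ c m₁ : ℕ, ∀ (m : ℕ) (hm : 1 ≤ m), m₁ ≤ m →
      haveI := hyp.isElliptic
      letI := IwasawaAlgebra.isDomain_quotient_X_pow_add_C p hm
      letI := IwasawaAlgebra.isDiscreteValuationRing_quotient_X_pow_add_C p hm
      haveI := IwasawaAlgebra.EisensteinCoeff.isLocalRing_succ p hm
      letI := IwasawaAlgebra.EisensteinCoeff.algebraOfSpecSucc p m
      haveI := W.isScalarTower_algebraOfSpecSucc (K := K) (p := p) (m := m)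
      letI := W.residueModuleSucc (K := K) (p := p) hm
      ∀ (S : Finset (IsDedekindDomain.HeightOneSpectrum (NumberField.RingOfIntegers K)))
        (hpS : ∀ v, ((p : ℕ) : NumberField.RingOfIntegers K) ∈ v.asIdeal → v ∈ S)
        (hbad : ∀ v, v ∉ S → ((p : ℕ) : NumberField.RingOfIntegers K) ∉ v.asIdeal →
          (W.baseChange K).HasGoodReductionAt v)
        (_hSN : ∀ v ∈ S, ((p : ℕ) : NumberField.RingOfIntegers K) ∈ v.asIdeal ∨
          ((N : ℕ) : NumberField.RingOfIntegers K) ∈ v.asIdeal)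
        (_hSσ : ∀ (σ : K ≃ₐ[ℚ] K) (v : IsDedekindDomain.HeightOneSpectrum (NumberField.RingOfIntegers K)),
          σ • v ∈ S → v ∈ S)
        (L : Set (IsDedekindDomain.HeightOneSpectrum (NumberField.RingOfIntegers K)))
        (hL : L ⊆ (W.eisensteinTower (κ.unitTwist (-1)) hm).degreeTwoPrimes p)
        (hLS : ∀ v ∈ L, v ∉ S) (jbar' : AlgebraicClosure K →+* ℂ) (cd : ConjugationDatum K)
        (Dd : ∀ k, DualityDatum p cd ((W.eisensteinTower (κ.unitTwist (-1)) hm).ρ k)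
          (IwasawaAlgebra.EisensteinCoeff p m (k + 1)))
        (fs : ∀ (k : ℕ) (n : Finset (IsDedekindDomain.HeightOneSpectrum (NumberField.RingOfIntegers K)))
          (v : IsDedekindDomain.HeightOneSpectrum (NumberField.RingOfIntegers K)),
          galoisCohomology ((W.eisensteinLevelQuot (κ.unitTwist (-1)) hm k n).toLocal (Sum.inr v)) 1 →+
            SingularQuotient (GaloisRep.toLocal v (W.eisensteinLevelQuot (κ.unitTwist (-1)) hm k n)) ⊗[ℤ]
              Gell v)
        (hy : (W.eisensteinDVRSetting (κ.unitTwist (-1)) hm S hpS hbad L hL hLS jbar' cd Dd fs).SatisfiesH)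
        (hπ : (W.eisensteinDVRSetting (κ.unitTwist (-1)) hm S hpS hbad L hL hLS jbar' cd Dd fs).π ∈ IsLocalRing.maximalIdeal (IwasawaAlgebra p ⧸ Ideal.span {(PowerSeries.X ^ m + PowerSeries.C (p : ℤ_[p]) : IwasawaAlgebra p)}))
        (he : ∀ k, (W.eisensteinDVRSetting (κ.unitTwist (-1)) hm S hpS hbad L hL hLS jbar' cd Dd fs).e k ≤ (W.eisensteinDVRSetting (κ.unitTwist (-1)) hm S hpS hbad L hL hLS jbar' cd Dd fs).e (k + 1))
        (hπX : (W.eisensteinDVRSetting (κ.unitTwist (-1)) hm S hpS hbad L hL hLS jbar' cd Dd fs).π =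
          Ideal.Quotient.mk (Ideal.span {(PowerSeries.X ^ m + PowerSeries.C (p : ℤ_[p]) : IwasawaAlgebra p)}) PowerSeries.X)
        (hek : ∀ k, (W.eisensteinDVRSetting (κ.unitTwist (-1)) hm S hpS hbad L hL hLS jbar' cd Dd fs).e (k + 1) - (W.eisensteinDVRSetting (κ.unitTwist (-1)) hm S hpS hbad L hL hLS jbar' cd Dd fs).e k = m),
        Finite (↥((((W.baseChange K).conjSelmerInfty κ γ - 1) ^ m + (p : AddMonoid.End ((W.baseChange K).selmerInfty κ))).ker) ⧸ ((((W.eisensteinDVRSetting (κ.unitTwist (-1)) hm S hpS hbad L hL hLS jbar' cd Dd fs).T.selmerA (W.eisensteinDVRSetting (κ.unitTwist (-1)) hm S hpS hbad L hL hLS jbar' cd Dd fs).π (W.eisensteinDVRSetting (κ.unitTwist (-1)) hm S hpS hbad L hL hLS jbar' cd Dd fs).e hy.killed hy.ker_red hπ he (fun k ↦ ((W.eisensteinDVRSetting (κ.unitTwist (-1)) hm S hpS hbad L hL hLS jbar' cd Dd fs).t k).cond)).map (W.eisensteinTowerReadout κ hm (W.eisensteinDVRSetting (κ.unitTwist (-1))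 hm S hpS hbad L hL hLS jbar' cd Dd fs).π (W.eisensteinDVRSetting (κ.unitTwist (-1)) hm S hpS hbad L hL hLS jbar' cd Dd fs).e hy.killed hy.ker_red hπ he hπX hek)).comap ((W.baseChange K).selmerInfty κ).subtype).addSubgroupOf ((((W.baseChange K).conjSelmerInfty κ γ - 1) ^ m + (p : AddMonoid.End ((W.baseChange K).selmerInfty κ))).ker)) ∧
          Nat.card (↥((((W.baseChange K).conjSelmerInfty κ γ - 1) ^ m + (p : AddMonoid.End ((W.baseChange K).selmerInfty κ))).ker) ⧸ ((((W.eisensteinDVRSetting (κ.unitTwist (-1)) hm S hpS hbad L hL hLS jbar' cd Dd fs).T.selmerA (W.eisensteinDVRSetting (κ.unitTwist (-1)) hm S hpS hbad L hL hLS jbar' cd Dd fs).π (W.eisensteinDVRSetting (κ.unitTwist (-1)) hm S hpS hbad L hL hLS jbar' cd Dd fs).e hy.killed hy.ker_red hπ he (fun k ↦ ((W.eisensteinDVRSetting (κ.unitTwist (-1)) hm S hpS hbad L hL hLS jbar' cd Dd fs).t k).cond)).map (W.eisensteinTowerReadout κ hm (W.eisensteinDVRSetting (κ.unitTwist (-1))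 hm S hpS hbad L hL hLS jbar' cd Dd fs).π (W.eisensteinDVRSetting (κ.unitTwist (-1)) hm S hpS hbad L hL hLS jbar' cd Dd fs).e hy.killed hy.ker_red hπ he hπX hek)).comap ((W.baseChange K).selmerInfty κ).subtype).addSubgroupOf ((((W.baseChange K).conjSelmerInfty κ γ - 1) ^ m + (p : AddMonoid.End ((W.baseChange K).selmerInfty κ))).ker)) ≤ p ^ c

set_option synthInstance.maxHeartbeats 80000 in
/-- **Letter of `stub_controlGlue`**: skeleton v7's `Stmt.controlGlueKS` VERBATIM (hKS leading binder, `_hSN`/`_hSσ` after `hbad`),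
with `ctrlLevel` inlined (`fun k ↦ I.proj (k+1) (D.toEisensteinH1Linear … z)`, definitionally equal) and ONE inserted
hypothesis `z ≠ 0` after the torsion clause (available in `portCyclic_of` from STUB A's `κ.one ≠ 0` and the link). -/
abbrev Stmt.controlGlueKS : Prop :=
  Stmt.kummerStrictOnFrames →
  ∀ (N : ℕ) [NeZero N] (W : WeierstrassCurve ℚ) [W.IsGloballyMinimal] (K : Type) [Field K] [NumberField K]
    (p : ℕ) [Fact p.Prime] (κ : ZpExtension K p) (γ : Field.absoluteGaloisGroup K)
    (jbar : AlgebraicClosure K →+* ℂ) (hyp : CastellaGrossiLeeSkinner2022.Thm413Hypotheses N W K p κ γ),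
    ¬ W.HasCM → W.HasIrreducibleModPGaloisRep p → (W.baseChange K).HasIrreducibleModPGaloisRep p →
    MastellaZerman2026.HasPadicScalarImage W p → SatisfiesHeegnerHypothesis p K →
    p ∣ NumberField.classNumber K →
    ∀ (D : (W.baseChange K).LambdaAdicSelmerData κ γ)
      (C : CastellaGrossiLeeSkinner2022.StabilizedHeegnerData N W K κ jbar)
      (X : (W.baseChange K).SelmerDualData κ γ) (z : D.S),
    (∀ (k : ℕ) (hk : C.depth < k), D.proj k z ∈ CastellaGrossiLeeSkinner2022.stabilizedClassLayer C k hk) →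
    CastellaGrossiLeeSkinner2022.stabilizedHeegnerModule D C = Submodule.span (IwasawaAlgebra p) {z} →
    Module.Finite (IwasawaAlgebra p) D.S → Module.Finite (IwasawaAlgebra p) X.X →
    Module.IsTorsion (IwasawaAlgebra p) (D.S ⧸ CastellaGrossiLeeSkinner2022.stabilizedHeegnerModule D C) →
    z ≠ 0 →
    ∃ c m₁ : ℕ, ∀ (m : ℕ) (hm : 1 ≤ m), m₁ ≤ m →
      haveI := hyp.isElliptic
      letI := IwasawaAlgebra.isDomain_quotient_X_pow_add_C p hm
      letI := IwasawaAlgebra.isDiscreteValuationRing_quotient_X_pow_add_C p hm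
      haveI := IwasawaAlgebra.EisensteinCoeff.isLocalRing_succ p hm
      letI := IwasawaAlgebra.EisensteinCoeff.algebraOfSpecSucc p m
      haveI := W.isScalarTower_algebraOfSpecSucc (K := K) (p := p) (m := m)
      letI := W.residueModuleSucc (K := K) (p := p) hm
      ∀ (S : Finset (IsDedekindDomain.HeightOneSpectrum (NumberField.RingOfIntegers K)))
        (hpS : ∀ v, ((p : ℕ) : NumberField.RingOfIntegers K) ∈ v.asIdeal → v ∈ S)
        (hbad : ∀ v, v ∉ S → ((p : ℕ) : NumberField.RingOfIntegers K) ∉ v.asIdeal →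
          (W.baseChange K).HasGoodReductionAt v)
        (_hSN : ∀ v ∈ S, ((p : ℕ) : NumberField.RingOfIntegers K) ∈ v.asIdeal ∨
          ((N : ℕ) : NumberField.RingOfIntegers K) ∈ v.asIdeal)
        (_hSσ : ∀ (σ : K ≃ₐ[ℚ] K) (v : IsDedekindDomain.HeightOneSpectrum (NumberField.RingOfIntegers K)),
          σ • v ∈ S → v ∈ S)
        (L : Set (IsDedekindDomain.HeightOneSpectrum (NumberField.RingOfIntegers K)))
        (hL : L ⊆ (W.eisensteinTower (κ.unitTwist (-1)) hm).degreeTwoPrimes p)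
        (hLS : ∀ v ∈ L, v ∉ S) (jbar' : AlgebraicClosure K →+* ℂ) (cd : ConjugationDatum K)
        (Dd : ∀ k, DualityDatum p cd ((W.eisensteinTower (κ.unitTwist (-1)) hm).ρ k)
          (IwasawaAlgebra.EisensteinCoeff p m (k + 1)))
        (fs : ∀ (k : ℕ) (n : Finset (IsDedekindDomain.HeightOneSpectrum (NumberField.RingOfIntegers K)))
          (v : IsDedekindDomain.HeightOneSpectrum (NumberField.RingOfIntegers K)),
          galoisCohomology ((W.eisensteinLevelQuot (κ.unitTwist (-1)) hm k n).toLocal (Sum.inr v)) 1 →+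
            SingularQuotient (GaloisRep.toLocal v (W.eisensteinLevelQuot (κ.unitTwist (-1)) hm k n)) ⊗[ℤ]
              Gell v)
        (t : ∀ k, ((W.baseChange K).torsionGaloisModule ((p : ℤ) ^ (k + 1))).toContRepresentation →ⁱL
          ((W.baseChange K).torsionGaloisModule ((p : ℤ) ^ k)).toContRepresentation)
        (ht : ∀ k (P : geomTorsion (W.baseChange K) ((p : ℤ) ^ (k + 1))),
          t k P = (W.baseChange K).geomTorsionReduce p k P)
        (I : ZpExtension.EisensteinH1Data (κ.unitTwist (-1))
          (fun k ↦ (W.baseChange K).torsionGaloisModule ((p : ℤ) ^ k)) t hm)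
        (hy : (W.eisensteinDVRSetting (κ.unitTwist (-1)) hm S hpS hbad L hL hLS jbar' cd Dd fs).SatisfiesH),
        (W.eisensteinDVRSetting (κ.unitTwist (-1)) hm S hpS hbad L hL hLS jbar' cd Dd fs).Conclusion hy
            (fun k ↦ I.proj (k + 1) (D.toEisensteinH1Linear hm t ht I hyp.topGenerator hyp.noPTorsion z)) →
          Nonempty (HeegnerMuPartStabilized.SpecWitness (IwasawaAlgebra p) D.S X.X
            (CastellaGrossiLeeSkinner2022.stabilizedHeegnerModule D C)
            (PowerSeries.X ^ m + PowerSeries.C (p : ℤ_[p]) : IwasawaAlgebra p) (p ^ c))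

/-! ## §2 The assembly -/

set_option maxHeartbeats 1600000 in
set_option synthInstance.maxHeartbeats 80000 in
/-- **`stub_controlGlue` from the two readout clauses** (see the module docstring for the chain).
[cite: Howard2004HeegnerKolyvagin, Thm. 1.6.1, Prop. 2.2.8 and proof of Thm. 2.2.10 (𝔮 = T^m + p)]
[cite: GreenbergLNM1716, Prop. 2.4 and §4 p. 98] [cite: MastellaZerman2026, Thm. 2.40] -/
theorem controlGlueKS_of_clauses (hB4 : Stmt.readoutSelmerKS) (hB5 : Stmt.readoutIndexKS) : Stmt.controlGlueKS := by
  intro hKS N _ W _ K _ _ p _ κ γ jbar hyp hCM hirr hirrK hsc hHp hhK D C X z hz hcyc hfinS hfinX htor hz0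
  haveI := hyp.isElliptic
  haveI : Module.Finite (IwasawaAlgebra p) D.S := hfinS
  have htor' : Module.IsTorsion (IwasawaAlgebra p) (D.S ⧸ (IwasawaAlgebra p) ∙ z) := by
    rw [← hcyc]; exact htor
  -- the m-UNIFORM constants: compact side (p660971), (B4), (B5)
  obtain ⟨n₁, m₂, hA⟩ := PrintX10bCompactControl.exists_forall_compactInputs_eisensteinDVRSetting W K p κ γ D
    hyp.topGenerator hyp.noPTorsion z hz0 htor'
  obtain ⟨m₄, hSelAll⟩ := hB4 hKS N W K p κ γ jbar hyp hCM hirr hirrK hsc hHp hhK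
  obtain ⟨c₂, m₃, hIdxAll⟩ := hB5 hKS N W K p κ γ jbar hyp hCM hirr hirrK hsc hHp hhK
  refine ⟨max (p ^ n₁) c₂, p ^ n₁ + 1 + m₂ + m₃ + m₄, fun m hm hmle ↦ ?_⟩
  letI := IwasawaAlgebra.isDomain_quotient_X_pow_add_C p hm
  letI := IwasawaAlgebra.isDiscreteValuationRing_quotient_X_pow_add_C p hm
  haveI := IwasawaAlgebra.EisensteinCoeff.isLocalRing_succ p hm
  letI := IwasawaAlgebra.EisensteinCoeff.algebraOfSpecSucc p m
  haveI := W.isScalarTower_algebraOfSpecSucc (K := K) (p := p) (m := m)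
  letI := W.residueModuleSucc (K := K) (p := p) hm
  have hn₁m : p ^ n₁ < m := by omega
  have hm₂m : m₂ ≤ m := by omega
  have hm₃m : m₃ ≤ m := by omega
  have hm₄m : m₄ ≤ m := by omega
  have hppos : 0 < p := (Fact.out : p.Prime).pos
  intro S hpS hbad hSN hSσ L hL hLS jbar' cd Dd fs t ht I hy hconc
  obtain rfl := PrintX10bCompactControl.eq_torsionGaloisModuleReduce t ht
  have ht' : ∀ k, Function.Surjective ((W.baseChange K).torsionGaloisModuleReduce p k) :=
    fun k ↦ (W.baseChange K).torsionGaloisModuleReduce_surjective p k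
  -- the four bookkeeping proofs of the readout
  have hπ₀ : (W.eisensteinDVRSetting (κ.unitTwist (-1)) hm S hpS hbad L hL hLS jbar' cd Dd fs).π ∈ IsLocalRing.maximalIdeal (IwasawaAlgebra p ⧸ Ideal.span {(PowerSeries.X ^ m + PowerSeries.C (p : ℤ_[p]) : IwasawaAlgebra p)}) := by
    rw [hy.unif]; exact Ideal.mem_span_singleton_self _
  have he₀ : ∀ k, (W.eisensteinDVRSetting (κ.unitTwist (-1)) hm S hpS hbad L hL hLS jbar' cd Dd fs).e k ≤ (W.eisensteinDVRSetting (κ.unitTwist (-1)) hm S hpS hbad L hL hLS jbar' cd Dd fs).e (k + 1) := fun k ↦ (hy.e_strictMono (Nat.lt_succ_self k)).le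
  have hπX : (W.eisensteinDVRSetting (κ.unitTwist (-1)) hm S hpS hbad L hL hLS jbar' cd Dd fs).π = Ideal.Quotient.mk (Ideal.span {(PowerSeries.X ^ m + PowerSeries.C (p : ℤ_[p]) : IwasawaAlgebra p)}) PowerSeries.X := rfl
  have hek : ∀ k, (W.eisensteinDVRSetting (κ.unitTwist (-1)) hm S hpS hbad L hL hLS jbar' cd Dd fs).e (k + 1) - (W.eisensteinDVRSetting (κ.unitTwist (-1)) hm S hpS hbad L hL hLS jbar' cd Dd fs).e k = m := by
    intro k
    rw [W.eisensteinDVRSetting_e, W.eisensteinDVRSetting_e, Nat.mul_succ, Nat.add_sub_cancel_left]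
  -- (B4), (B5) at this `m` and datum
  have hSel := hSelAll m hm hm₄m S hpS hbad hSN hSσ L hL hLS jbar' cd Dd fs hy hπ₀ he₀ hπX hek
  obtain ⟨hfin, hidx⟩ := hIdxAll m hm hm₃m S hpS hbad hSN hSσ L hL hLS jbar' cd Dd fs hy hπ₀ he₀ hπX hek
  -- the control image lies in the pinned `H¹_{F_𝔮}` (ORD-ASCENT, p661609)
  have hf := fun s ↦ LambdaAdicSelmerData.toEisensteinH1Linear_mem_ordinarySelmer_of_thm413Hypotheses hyp D hm _ ht I
    S hpS hbad s
  -- the honest `S_m`-module `H := H¹_{F_𝔮}(K, T_𝔮)` (p658581)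
  letI := (I.isTorsionBy_qm_submodule (I.selmerSubmodule ((κ.unitTwist (-1)).eisensteinSelmerStructure (fun k ↦ (W.baseChange K).torsionGaloisModule ((p : ℤ) ^ k)) (fun k ↦ (W.baseChange K).torsionGaloisModuleReduce p k) hm S (fun v _ ↦ (W.baseChange K).ordinaryFiltrationAt v (fun k ↦ (W.baseChange K).torsionGaloisModuleReduce p k) ht)) (fun k c x hx ↦ (κ.unitTwist (-1)).map_eisensteinTwistSMulHom_mem_selmerGroup (fun k ↦ (W.baseChange K).torsionGaloisModule ((p : ℤ) ^ k)) (fun k ↦ (W.baseChange K).torsionGaloisModuleReduce p k) hm S (fun v _ ↦ (W.baseChange K).ordinaryFiltrationAt v (fun k ↦ (W.baseChange K).torsionGaloisModuleReduce p k) ht) k c x hx))).module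
  haveI := I.isScalarTower_qm_submodule (I.selmerSubmodule ((κ.unitTwist (-1)).eisensteinSelmerStructure (fun k ↦ (W.baseChange K).torsionGaloisModule ((p : ℤ) ^ k)) (fun k ↦ (W.baseChange K).torsionGaloisModuleReduce p k) hm S (fun v _ ↦ (W.baseChange K).ordinaryFiltrationAt v (fun k ↦ (W.baseChange K).torsionGaloisModuleReduce p k) ht)) (fun k c x hx ↦ (κ.unitTwist (-1)).map_eisensteinTwistSMulHom_mem_selmerGroup (fun k ↦ (W.baseChange K).torsionGaloisModule ((p : ℤ) ^ k)) (fun k ↦ (W.baseChange K).torsionGaloisModuleReduce p k) hm S (fun v _ ↦ (W.baseChange K).ordinaryFiltrationAt v (fun k ↦ (W.baseChange K).torsionGaloisModuleReduce p k) ht) k c x hx))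
  -- Howard's conclusion (i), for the compact turnkey (the conclusion itself stays available, unopened)
  have hconc' := hconc
  obtain ⟨x, hfree, -⟩ := hconc'
  obtain ⟨⟨hcoker, hcoker_le⟩, hfz⟩ := hA m hm hn₁m hm₂m S hpS hbad L hL hLS jbar' cd Dd fs _ ht I hf x hfree
  -- the discrete turnkey (p669215)
  exact HeegnerMuPartStabilized.nonempty_specWitness_of_dvrConclusion_of_readout hm
    (CastellaGrossiLeeSkinner2022.stabilizedHeegnerModule D C) (W.baseChange K) hyp.topGenerator X
    (W.eisensteinDVRSetting (κ.unitTwist (-1)) hm S hpS hbad L hL hLS jbar' cd Dd fs) hy hπ₀ he₀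
    (fun k ↦ I.proj (k + 1) (D.toEisensteinH1Linear hm _ ht I hyp.topGenerator hyp.noPTorsion z))
    (PrintX10bCompactControl.proj_succ_mem_limitSelmer_eisensteinDVRSetting W K p κ hm S hpS hbad L hL hLS jbar' cd
      Dd fs _ ht I (hf z))
    (PrintX10bCompactControl.proj_succ_ne_zero I ht' hfz) hconc
    ((AddMonoidHom.pi (fun k ↦ I.proj (k + 1))).comp (I.selmerSubmodule ((κ.unitTwist (-1)).eisensteinSelmerStructure (fun k ↦ (W.baseChange K).torsionGaloisModule ((p : ℤ) ^ k)) (fun k ↦ (W.baseChange K).torsionGaloisModuleReduce p k) hm S (fun v _ ↦ (W.baseChange K).ordinaryFiltrationAt v (fun k ↦ (W.baseChange K).torsionGaloisModuleReduce p k) ht)) (fun k c x hx ↦ (κ.unitTwist (-1)).map_eisensteinTwistSMulHom_mem_selmerGroup (fun k ↦ (W.baseChange K).torsionGaloisModule ((p : ℤ) ^ k)) (fun k ↦ (W.baseChange K).torsionGaloisModuleReduce p k) hm S (fun v _ ↦ (W.baseChange K).ordinaryFiltrationAt v (fun k ↦ (W.baseChange K).torsionGaloisModuleReduce p k) ht)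 k c x hx)).subtype.toAddMonoidHom)
    ((I.injective_projSucc ht').comp Subtype.val_injective)
    (fun y ↦ I.mem_limitSelmer_succ_iff_mem_range ht' S _ y)
    (fun r y ↦ I.projSucc_smul ht' (I.selmerSubmodule ((κ.unitTwist (-1)).eisensteinSelmerStructure (fun k ↦ (W.baseChange K).torsionGaloisModule ((p : ℤ) ^ k)) (fun k ↦ (W.baseChange K).torsionGaloisModuleReduce p k) hm S (fun v _ ↦ (W.baseChange K).ordinaryFiltrationAt v (fun k ↦ (W.baseChange K).torsionGaloisModuleReduce p k) ht)) (fun k c x hx ↦ (κ.unitTwist (-1)).map_eisensteinTwistSMulHom_mem_selmerGroup (fun k ↦ (W.baseChange K).torsionGaloisModule ((p : ℤ) ^ k)) (fun k ↦ (W.baseChange K).torsionGaloisModuleReduce p k) hm S (fun v _ ↦ (W.baseChange K).ordinaryFiltrationAt v (fun k ↦ (W.baseChange K).torsionGaloisModuleReduce p k) ht) k c x hx)) r y)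
    ((D.toEisensteinH1Linear hm _ ht I hyp.topGenerator hyp.noPTorsion).codRestrict (I.selmerSubmodule ((κ.unitTwist (-1)).eisensteinSelmerStructure (fun k ↦ (W.baseChange K).torsionGaloisModule ((p : ℤ) ^ k)) (fun k ↦ (W.baseChange K).torsionGaloisModuleReduce p k) hm S (fun v _ ↦ (W.baseChange K).ordinaryFiltrationAt v (fun k ↦ (W.baseChange K).torsionGaloisModuleReduce p k) ht)) (fun k c x hx ↦ (κ.unitTwist (-1)).map_eisensteinTwistSMulHom_mem_selmerGroup (fun k ↦ (W.baseChange K).torsionGaloisModule ((p : ℤ) ^ k)) (fun k ↦ (W.baseChange K).torsionGaloisModuleReduce p k) hm S (fun v _ ↦ (W.baseChange K).ordinaryFiltrationAt v (fun k ↦ (W.baseChange K).torsionGaloisModuleReduce p k) ht) k c x hx)) hf)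
    ((D.toEisensteinH1Linear hm _ ht I hyp.topGenerator hyp.noPTorsion).codRestrict (I.selmerSubmodule ((κ.unitTwist (-1)).eisensteinSelmerStructure (fun k ↦ (W.baseChange K).torsionGaloisModule ((p : ℤ) ^ k)) (fun k ↦ (W.baseChange K).torsionGaloisModuleReduce p k) hm S (fun v _ ↦ (W.baseChange K).ordinaryFiltrationAt v (fun k ↦ (W.baseChange K).torsionGaloisModuleReduce p k) ht)) (fun k c x hx ↦ (κ.unitTwist (-1)).map_eisensteinTwistSMulHom_mem_selmerGroup (fun k ↦ (W.baseChange K).torsionGaloisModule ((p : ℤ) ^ k)) (fun k ↦ (W.baseChange K).torsionGaloisModuleReduce p k) hm S (fun v _ ↦ (W.baseChange K).ordinaryFiltrationAt v (fun k ↦ (W.baseChange K).torsionGaloisModuleReduce p k) ht) k c x hx)) hf z) rfl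
    (by rw [hcyc, Submodule.map_span, Set.image_singleton])
    (p ^ max (p ^ n₁) c₂) hcoker (hcoker_le.trans (Nat.pow_le_pow_right hppos (le_max_left _ _)))
    (W.eisensteinTowerReadout κ hm (W.eisensteinDVRSetting (κ.unitTwist (-1)) hm S hpS hbad L hL hLS jbar' cd Dd fs).π (W.eisensteinDVRSetting (κ.unitTwist (-1)) hm S hpS hbad L hL hLS jbar' cd Dd fs).e hy.killed hy.ker_red hπ₀ he₀ hπX hek)
    ((W.baseChange K).conjH1 p κ.kerSubgroup γ) (fun _ ↦ rfl)
    (fun j cj ↦ W.eisensteinTowerReadout_of_scalarMapH1_mk_X κ hm (W.eisensteinDVRSetting (κ.unitTwist (-1)) hm S hpS hbad L hL hLS jbar' cd Dd fs).π (W.eisensteinDVRSetting (κ.unitTwist (-1)) hm S hpS hbad L hL hLS jbar' cd Dd fs).e hy.killed hy.ker_red hπ₀ he₀ hπX hek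
      hyp.topGenerator _ (fun _ ↦ rfl) j cj)
    hSel hfin (hidx.trans (Nat.pow_le_pow_right hppos (le_max_right _ _)))

end Summit.BirchSwinnertonDyer.BirchSwinnertonDyer.Theorems.HeegnerMuPartControlGlue

end
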